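import Literature.MathematicalPhysics.QuantumFieldTheory.Balaban1983to89.HiggsDoubleRT
import Literature.MathematicalPhysics.QuantumFieldTheory.Balaban1983to89.HiggsActionIntegrable
import Literature.MathematicalPhysics.QuantumFieldTheory.Balaban1983to89.B2Eq21FirstStep

/-!
# `Balaban1983to89.B1Ineq36HiggsModel` — T. Bałaban, *(Higgs)₂,₃ quantum fields in a finite volume. I. A lower bound*,
Commun. Math. Phys. **85** (1982) 603–626 [Balaban1982Higgs1], **(3.6)** p. 613: the first lower-bound step
`Z^ε ≥ ∫dB∫dψ χ₁(B)χ₁(ψ) T^ε_{a,L}[T^ε_{a,L,A}[χ₀(A)χ₀(φ)exp(−S^ε)]]` FOR THE MODEL ITSELF — r14's abstract kernel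
inequality `B1Ineq36LowerStep.integral_cutoff_double_cutoff_le` (the row's theorem of record) with every hypothesis
DISCHARGED over the concrete carriers: the double transformation `B2Eq21FirstStep.doubleRT` (II (2.1)), identified with the
level-`0` case of `HiggsDoubleRT.doubleRTk` at the external field `A` itself, the action `HiggsLattice.action` (1.11) with
`exp(−S^ε) ∈ L¹`, `Z^ε > 0` from `HiggsActionIntegrable`, and ARBITRARY measurable weights `0 ≤ χ₀, χ₁ ≤ 1`

statement-level skeleton of published theorems with citation tags; proofs where landed; nothing here is a claim about the Yang–Mills mass gap

PDF held: `paper:balaban1982-cmp85-higgs23-i` (journal page = PDF page + 602).  Display (3.6) read from the ×2 render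
`run/shared/lean/pub/pub-balaban/b2b-balaban-ref1/pages/1982-cmp85-higgs23-I/1982-cmp85-higgs23-I-p011-x2.png` (p. 613),
never from the OCR layer.

CITATION HEADER (lean-in-tree rule).  lit-balaban typed skeleton (HOME `run/shared/lean/pub/lit-balaban/`), SKELETON row
**B1.Eq3.6** (owner r14; theorem of record = r14's MECHANISM `B1Ineq36LowerStep.integral_cutoff_double_cutoff_le` for
arbitrary normalized non-negative double kernels; this module is its INSTANCE for the model — through
`HiggsDoubleRT.lowerStepK_exp`, which applies it by name — and is not a restatement of it).  WHAT IS REPRODUCED: p. 613,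
verbatim: *"and the following inequality holds Z^ε ≥ ∫dB∫dψ χ₁(B)χ₁(ψ) T^ε_{a,L}[T^ε_{a,L,A}[χ₀(A)χ₀(φ)exp(−S^ε)]]. (3.6)
We have to calculate T^ε_{a,L}[T^ε_{a,L,A}[χ₀(A)χ₀(φ)exp(−S^ε)]] under the restrictions on the fields B, ψ introduced by
the characteristic functions χ₁(B)χ₁(ψ)."*  DICTIONARY: `Z^ε` = `HiggsLattice.partitionFn` ((1.10) p. 605); the double
transformation = `B2Eq21FirstStep.doubleRT` (the scalar-field transformation (2.4)–(2.7) `HiggsAveraging.renormTransf` at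
the external field `A`, then the vector-field transformation with the block kernel (2.5) at the plain average
`B2Eq21FirstStep.linAvg` of `x ↦ (A_μ(x))_μ`) — EQUAL (`doubleRT_eq_doubleRTk`, via `B2Eq21FirstStep.avgQ_zero`:
`Q(0) = Q`) to `HiggsDoubleRT.doubleRTk C a (A ↦ A)` at level `0`, whose kernel is p. 608's *"N = d, external field
A = 0"* literally; `S^ε` = `HiggsLattice.action` (1.11); `∫dB∫dψ` = product Lebesgue measure (p. 605); `χ₀(A, φ)`,
`χ₁(B, ψ)` are ARBITRARY measurable weights with values in `[0, 1]` — (3.1)–(3.2), (3.4)–(3.5) are such (the printed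
ones, `B1Eq31Concrete.chi0A/chi0φ/chi1B/chi1ψ`, are inserted in `B1Ineq36Printed`), so (3.6) as printed is the special
case `lowerStep36_prod`.
PROVED: `doubleRT_eq_doubleRTk` (the bridge), (2.9) for `doubleRT` (`integral_doubleRT`), positivity and integrability of
`T^ε_{a,L}[T^ε_{a,L,A}[ρ]]`, **(3.6)** `lowerStep36` (general weights; hypotheses `a > 0` and the standing assumptions
*"μ₀² > 0 and λ > 0"* of p. 605 — `HiggsActionIntegrable.integrable_exp_neg_action`) and `lowerStep36_prod` (product
weights `χ₀(A)χ₀(φ)`, `χ₁(B)χ₁(ψ)`).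
DELIBERATELY NOT HERE: the specific characteristic functions (3.1)–(3.5) (row B1.Eq3.1; `B1Ineq36Printed`); anything
after (3.6).
Unit `lit-balaban-typer` gen 2–3 (literature-prover-lit-balaban-typer-g2-0, -g3-0); HOME/FILED.md records the proposal.
-/

open scoped BigOperators
open _root_.MeasureTheory

namespace Literature.MathematicalPhysics.QuantumFieldTheory.Balaban1983to89.B1Ineq36HiggsModel

open Literature.MathematicalPhysics.QuantumFieldTheory.Balaban1983to89.HiggsLattice
open Literature.MathematicalPhysics.QuantumFieldTheory.Balaban1983to89.HiggsAveraging
open Literature.MathematicalPhysics.QuantumFieldTheory.Balaban1983to89.B1RT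
open Literature.MathematicalPhysics.QuantumFieldTheory.Balaban1983to89.HiggsDoubleRT
open Literature.MathematicalPhysics.QuantumFieldTheory.Balaban1983to89.HiggsActionIntegrable
open Literature.MathematicalPhysics.QuantumFieldTheory.Balaban1983to89.B2Eq21FirstStep (linAvg avgQ_zero doubleRT)
open Literature.MathematicalPhysics.QuantumFieldTheory.Balaban1983to89.B3MultiscaleFields (toSite zeroCharge)

variable {P : Params} {N : ℕ}

/-! ## 1. The bridge: `B2Eq21FirstStep.doubleRT` is `HiggsDoubleRT.doubleRTk` at level `0`, external field `A` -/

section Bridge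

/-- The vector-field kernel of `B2Eq21FirstStep.doubleRT` (the block kernel (2.5) at the plain average `Q` of
`x ↦ (A_μ(x))_μ`) IS `HiggsDoubleRT.vecKernel` at level `0` — because `Q(0) = Q` (`B2Eq21FirstStep.avgQ_zero`), the
p. 608 recipe *"taking N = d and an external vector field A = 0"*. [cite: Balaban1982Higgs1, (2.5) p.608] -/
theorem blockKernel_linAvg_eq_vecKernel (a : ℝ) (B : VecField P 1) (A : VecField P 0) :
    blockKernel (prec a (P.mesh 1) P.d) linAvg (toSite B) (toSite A) = vecKernel a B A := by
  have h : (linAvg : ScalarField P 0 P.d → ScalarField P 1 P.d)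
      = avgQ (k := 0) (zeroCharge P.d) (0 : VecField P 0) := by
    funext φ
    exact (avgQ_zero (zeroCharge P.d) φ).symm
  rw [vecKernel_eq, h]

/-- **`T^ε_{a,L}[T^ε_{a,L,A}[ρ]]` (II (2.1), `B2Eq21FirstStep.doubleRT`) = the level-`0` double transformation of
`HiggsDoubleRT` at the external-field assignment `A ↦ A`.** [cite: Balaban1982Higgs1, (3.6) p.613] -/
theorem doubleRT_eq_doubleRTk (C : ChargeData N) (a : ℝ) (ρ : VecField P 0 → ScalarField P 0 N → ℝ) (B : VecField P 1)
    (ψ : ScalarField P 1 N) : doubleRT C a ρ B ψ = doubleRTk C a (fun A : VecField P 0 => A) ρ B ψ := by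
  unfold doubleRT doubleRTk
  refine integral_congr_ae (Filter.Eventually.of_forall fun A => ?_)
  simp only [blockKernel_linAvg_eq_vecKernel]

/-- **(2.9) for the double transformation of (3.6)**: `∫dB∫dψ T^ε_{a,L}[T^ε_{a,L,A}[ρ]](B, ψ) = ∫dA∫dφ ρ(A, φ)` for every
integrable density `ρ`. PROVED (`HiggsDoubleRT.integral_doubleRTk`). [cite: Balaban1982Higgs1, (2.9) p.609] -/
theorem integral_doubleRT {a : ℝ} (ha : 0 < a) (C : ChargeData N) {ρ : VecField P 0 → ScalarField P 0 N → ℝ}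
    (hρ : Integrable fun Φ : VecField P 0 × ScalarField P 0 N => ρ Φ.1 Φ.2) :
    ∫ Ψ : VecField P 1 × ScalarField P 1 N, doubleRT C a ρ Ψ.1 Ψ.2
      = ∫ Φ : VecField P 0 × ScalarField P 0 N, ρ Φ.1 Φ.2 := by
  simp_rw [doubleRT_eq_doubleRTk]
  exact integral_doubleRTk ha C measurable_id' hρ

/-- The double transformation of a non-negative density is non-negative. [cite: Balaban1982Higgs1, (2.4) p.608] -/
theorem doubleRT_nonneg {a : ℝ} (ha : 0 < a) (C : ChargeData N) {ρ : VecField P 0 → ScalarField P 0 N → ℝ}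
    (hρ0 : ∀ A φ, 0 ≤ ρ A φ) (B : VecField P 1) (ψ : ScalarField P 1 N) : 0 ≤ doubleRT C a ρ B ψ := by
  rw [doubleRT_eq_doubleRTk]
  exact doubleRTk_nonneg ha C _ hρ0 B ψ

/-- The double transformation of an integrable density is integrable (`dB dψ`). [cite: Balaban1982Higgs1, (2.9) p.609] -/
theorem integrable_doubleRT {a : ℝ} (ha : 0 < a) (C : ChargeData N) {ρ : VecField P 0 → ScalarField P 0 N → ℝ}
    (hρ : Integrable fun Φ : VecField P 0 × ScalarField P 0 N => ρ Φ.1 Φ.2) :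
    Integrable fun Ψ : VecField P 1 × ScalarField P 1 N => doubleRT C a ρ Ψ.1 Ψ.2 := by
  simp_rw [doubleRT_eq_doubleRTk]
  exact integrable_doubleRTk ha C measurable_id' hρ

end Bridge

/-! ## 2. (3.6) for the model -/

section LowerStep

/-- **(3.6) p. 613 for the (Higgs)₂,₃ model, general weights**: for `a > 0`, couplings with `μ₀² > 0`, `λ > 0`, and any
measurable weights `0 ≤ χ₀(A, φ) ≤ 1`, `0 ≤ χ₁(B, ψ) ≤ 1`,
`∫dB∫dψ χ₁(B, ψ) T^ε_{a,L}[T^ε_{a,L,A}[χ₀ exp(−S^ε)]](B, ψ) ≤ Z^ε`.  PROVED: r14's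
`B1Ineq36LowerStep.integral_cutoff_double_cutoff_le` through `HiggsDoubleRT.lowerStepK_exp` (the kernel hypotheses) and
`HiggsActionIntegrable.integrable_exp_neg_action` (the density). [cite: Balaban1982Higgs1, (3.6) p.613] -/
theorem lowerStep36 {a : ℝ} (ha : 0 < a) (C : ChargeData N) (c : Couplings) (hmu : 0 < c.mu0sq) (hlam : 0 < c.lam)
    {χ₀ : VecField P 0 → ScalarField P 0 N → ℝ} {χ₁ : VecField P 1 → ScalarField P 1 N → ℝ}
    (hχ₀ : Measurable (Function.uncurry χ₀)) (c₀ : ∀ A φ, χ₀ A φ ∈ Set.Icc (0 : ℝ) 1)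
    (c₁ : ∀ B ψ, χ₁ B ψ ∈ Set.Icc (0 : ℝ) 1) :
    ∫ Ψ : VecField P 1 × ScalarField P 1 N,
        χ₁ Ψ.1 Ψ.2 * doubleRT C a (fun A φ => χ₀ A φ * Real.exp (-action C c A φ)) Ψ.1 Ψ.2
      ≤ partitionFn P 0 N C c := by
  simp_rw [doubleRT_eq_doubleRTk]
  rw [partitionFn_eq]
  exact lowerStepK_exp ha C measurable_id' (integrable_exp_neg_action C c hmu hlam) hχ₀ c₀ c₁

/-- **(3.6) p. 613 AS PRINTED** — product weights `χ₀(A)χ₀(φ)` ((3.1)–(3.2)) and `χ₁(B)χ₁(ψ)` ((3.4)–(3.5)), here any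
measurable `[0, 1]`-valued functions of the single fields:
`Z^ε ≥ ∫dB∫dψ χ₁(B)χ₁(ψ) T^ε_{a,L}[T^ε_{a,L,A}[χ₀(A)χ₀(φ)exp(−S^ε)]]`. PROVED. [cite: Balaban1982Higgs1, (3.6) p.613] -/
theorem lowerStep36_prod {a : ℝ} (ha : 0 < a) (C : ChargeData N) (c : Couplings) (hmu : 0 < c.mu0sq)
    (hlam : 0 < c.lam) {χA : VecField P 0 → ℝ} {χφ : ScalarField P 0 N → ℝ} {χB : VecField P 1 → ℝ}
    {χψ : ScalarField P 1 N → ℝ} (hχA : Measurable χA) (hχφ : Measurable χφ)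
    (cA : ∀ A, χA A ∈ Set.Icc (0 : ℝ) 1) (cφ : ∀ φ, χφ φ ∈ Set.Icc (0 : ℝ) 1) (cB : ∀ B, χB B ∈ Set.Icc (0 : ℝ) 1)
    (cψ : ∀ ψ, χψ ψ ∈ Set.Icc (0 : ℝ) 1) :
    ∫ Ψ : VecField P 1 × ScalarField P 1 N,
        χB Ψ.1 * χψ Ψ.2 * doubleRT C a (fun A φ => χA A * χφ φ * Real.exp (-action C c A φ)) Ψ.1 Ψ.2
      ≤ partitionFn P 0 N C c := by
  have h := lowerStep36 (P := P) ha C c hmu hlam (χ₀ := fun A φ => χA A * χφ φ) (χ₁ := fun B ψ => χB B * χψ ψ)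
    ((hχA.comp measurable_fst).mul (hχφ.comp measurable_snd))
    (fun A φ => ⟨mul_nonneg (cA A).1 (cφ φ).1, mul_le_one₀ (cA A).2 (cφ φ).1 (cφ φ).2⟩)
    (fun B ψ => ⟨mul_nonneg (cB B).1 (cψ ψ).1, mul_le_one₀ (cB B).2 (cψ ψ).1 (cψ ψ).2⟩)
  exact h

end LowerStep

end Literature.MathematicalPhysics.QuantumFieldTheory.Balaban1983to89.B1Ineq36HiggsModel
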